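import Mathlib
import HarnessLib
import Summits.QuantumFields.YangMills.Theses.PencilRigidity
import Summits.QuantumFields.YangMills.Theorems.PencilRigidityPlanarToEuclideanSO4
import Summits.QuantumFields.YangMills.Theorems.PencilRigidityCurvatureKernelBoundChartDerivativeBoundsFrame

/-!
# `PlanarToEuclidean` (item stmt-QuantumFields-9669, route PencilRigidity): planar + proper hypercubic
# invariance on `⁰𝒮` is full `SO(4)` invariance

Closes `Summit.QuantumFields.YangMills.Theses.PencilRigidity.PlanarToEuclidean`: for ANY label type `ι` and
any labelled Schwinger family `S` on `E = ℝ⁴`, invariance of every `S n k` on `⁰𝒮` under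
(H1) the proper signed permutations (determinant-one isometries permuting the axes up to sign) and
(H2) every determinant-one isometry fixing `e₂` and `e₃`
implies invariance under every determinant-one linear isometry of `ℝ⁴` (Osterwalder–Schrader E1, rotation
half).  The set of determinant-one isometries leaving `S` invariant on `⁰𝒮` is closed under composition and
inverses — `linActMulti` is an action (`linActMulti_trans`) and preserves `⁰𝒮` (the tree's
`CurvatureKernel.isOffDiagonal_linActMulti`) — so the exact generation theorem
`PlanarToEuclidean.so4_generation` of `PencilRigidityPlanarToEuclideanSO4.lean` applies.
Sources: Osterwalder–Schrader 1973 §2 (Euclidean covariance); folklore group theory.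
-/

noncomputable section

namespace Summit.QuantumFields.YangMills.Theorems

namespace PlanarToEuclidean

/-! ### `linActMulti` is an action -/

open Literature.MathematicalPhysics.QuantumLattice

variable {E : Type*} [NormedAddCommGroup E] [NormedSpace ℝ E] {n : ℕ}

/-- `linActMulti` is an action: `F_{(0, A then B)} = (F_{(0,A)})_{(0,B)}`. [folklore] -/
theorem linActMulti_trans (A B : E ≃ₗᵢ[ℝ] E) (F : SchwartzMap (Fin n → E) ℂ) :
    linActMulti (A.trans B) F = linActMulti B (linActMulti A F) := by
  ext x
  simp only [linActMulti_apply]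
  congr 1

/-- The identity acts trivially. [folklore] -/
theorem linActMulti_refl (F : SchwartzMap (Fin n → E) ℂ) :
    linActMulti (LinearIsometryEquiv.refl ℝ E) F = F := by
  ext x
  simp only [linActMulti_apply]
  congr 1

end PlanarToEuclidean

open Literature.MathematicalPhysics.QuantumLattice Literature.MathematicalPhysics.AQFT
  Literature.MathematicalPhysics.QuantumFieldTheory PlanarToEuclidean in
/-- **`PlanarToEuclidean`** (item stmt-QuantumFields-9669 of route PencilRigidity, shared verbatim with
MirrorModularBoosts and TransparentRPWall): invariance of a labelled Schwinger family on `⁰𝒮` under the proper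
signed permutations and under the determinant-one isometries fixing `e₂, e₃` implies invariance under every
determinant-one linear isometry of `ℝ⁴` — the invariance set is a subgroup (the action is multiplicative and
preserves `⁰𝒮`) and `so4_generation` applies. [folklore] -/
theorem PlanarToEuclidean_proof : Summit.QuantumFields.YangMills.Theses.PencilRigidity.PlanarToEuclidean := by
  unfold Summit.QuantumFields.YangMills.Theses.PencilRigidity.PlanarToEuclidean
  intro E ι S hH hPl n k R hR F hF
  have key := so4_generation
    (fun A : E ≃ₗᵢ[ℝ] E => LinearMap.det (A.toLinearEquiv : E →ₗ[ℝ] E) = 1 ∧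
      ∀ (n : ℕ) (k : Fin n → ι) (F : SchwartzMap (Fin n → E) ℂ),
        IsOffDiagonal F → S n k (linActMulti A F) = S n k F)
    ?_ ?_ ?_ ?_ R hR
  · exact key.2 n k F hF
  · -- closed under composition
    rintro A B ⟨hA, hA'⟩ ⟨hB, hB'⟩
    refine ⟨by rw [det_trans, hA, hB, one_mul], fun n k F hF => ?_⟩
    rw [linActMulti_trans, hB' n k _ (CurvatureKernel.isOffDiagonal_linActMulti A hF), hA' n k F hF]
  · -- closed under inverses
    rintro A ⟨hA, hA'⟩
    refine ⟨det_symm hA, fun n k F hF => ?_⟩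
    have h := hA' n k _ (CurvatureKernel.isOffDiagonal_linActMulti A.symm hF)
    rw [← linActMulti_trans, LinearIsometryEquiv.symm_trans_self, linActMulti_refl] at h
    exact h.symm
  · -- (H1)
    intro A hA hhyp
    exact ⟨hA, fun n k F hF => hH n k A hA hhyp F hF⟩
  · -- (H2)
    intro A hA h2 h3
    exact ⟨hA, fun n k F hF => hPl A hA h2 h3 n k F hF⟩

end Summit.QuantumFields.YangMills.Theorems

end
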